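import Summits.HodgeConjecture.HodgeConjecture.Theorems.LinearSystemTorelliTranscendentalOrSupportedStubOfMiddleOfPhantomGysin

/-!
# Crux `TranscendentalOrSupported` (stmt-HodgeConjecture-10853) — line `Sketch`, skeleton v7
# (isotypic bootstrap, Gysin form): the crux = its HC part ∧ its GHC-proper residue, with the
# REDUCTION ITSELF now a theorem of the tree

Route `LinearSystemTorelli`, crux `TranscendentalOrSupported` = GHC(2p, coniveau 1) in Grothendieck's
sub-Hodge form: for `X` smooth projective of dimension `2p` (`p ≥ 1`), a Hodge model `A`, rational
classes `b j ∈ H²ᵖ(X(ℂ); ℂ)` whose pulled-back span `W` is a sub-Hodge structure with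
`W ∩ H^{2p,0} = 0`, every `b j` lies in `N¹ H²ᵖ = supportedClasses X (2p) 1`.

HISTORY. v1–v3 (lead `…-10853-0`, card `curve-sweep-torelli`, kept as `Lines/Sketch_torelli.lean`):
Poincaré-duality ("Torelli") form, 5/7 stubs landed, residue proved crux-equivalent. v4 (lead
`…-c1-0`, card `isotypic-bootstrap-one-divisor`): isotypic split by strong induction on `dim W`,
stubs `stub_completelyReducible` p107582, `stub_bootstrap` p107474, `stub_rankOne` p107230 landed.
v5/v6.1 (lead `…-c2-0`): polarizability discharged in the tree (p112211), Lefschetz (1,1) routed into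
item 1081 at `p = 1` (`stub_cruxOne_of_middleDivisorSupport`, p114629), Deligne 8.2.8 eliminated by the
GYSIN form of the residue; `stub_gysinRangeRational` p115866, `stub_gysinRangeSubHodge` p116287,
`stub_bootstrapGeneral` p116401 landed — 2 sorries left, no literature debt.

THIS SKELETON (v7, lead `…-c3-0`): the whole composition of v6.1 — the glue `G¹ ≤ N¹`
(unconditional), `G¹` rationally spanned and sub-Hodge in every model, the induction engine (strong
induction on `dim W`: reducible ⇒ split by semisimplicity; irreducible line ⇒ Hodge line ⇒ HC part;
irreducible rank `≥ 2` ⇒ residue ⇒ bootstrap with `S = G¹` ⇒ `W ≤ G¹ ≤ N¹`), the `p = 1` calibration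
and the phantom-free sector — is LANDED as
`Theorems/LinearSystemTorelliTranscendentalOrSupportedStubOfMiddleOfPhantomGysin.lean` (p117181,
registered stub `stub_transcendentalOrSupported_of_middle_of_phantomGysin :
MiddleDivisorSupport → (residue) → TranscendentalOrSupported`, sorry-free, axioms standard). What is
left here is exactly the two open stubs and a one-line composition:

* `stub_middle` = route item stmt-HodgeConjecture-1081 `MiddleDivisorSupport` VERBATIM (the
  Hodge-conjecture part; closes by name when that item lands);
* `stub_phantomGysin` = the GHC-proper residue in Gysin form (`p ≥ 2`): every irreducible rationally
  spanned sub-Hodge structure `W ⊆ H²ᵖ(X^{2p})` of rank `≥ 2` without `(2p,0)`-part meets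
  `G¹ = ⨆ im (g_* : Hᵃ(Y) → H²ᵖ(X))` (all smooth projective `Y` of dimension `< 2p`) non-trivially —
  Voisin's effectivity problem (J. Open Math. Probl. 1 (2025) Conj. 4.7 / Prop. 4.8, §4.3 (32)), open
  for every `p ≥ 2`; first instance `Λ²T(S) ⊂ H⁴(S × S)`, `S` a K3 surface with `End_Hdg T(S) = ℚ`.

Conversely the crux implies `stub_middle` (glue item 2411, CLOSED:
`Theorems.linearSystemTorelli_supportedOfTranscendentalOrSupported_proof`) and implies
`stub_phantomGysin` modulo Deligne's Cor. 8.2.8 (LANDED as the registered stub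
`Theorems.stub_phantomGysin_of_transcendentalOrSupported`, p117363, file
`Theorems/LinearSystemTorelliTranscendentalOrSupportedStubResidueNecessary.lean`; workfile version
`Lines/Sketch_gysin.lean`): crux = 1081 ∧ residue, kernel-checked in the tree up to one classical
theorem. For the ROUTE note that `LinearSystemTorelli.closes` consumes the crux ONLY through item 2411
to obtain 1081.
-/

noncomputable section

set_option linter.dupNamespace false

open CategoryTheory
open Literature.AlgebraicGeometry.Motives Literature.AlgebraicGeometry.HodgeTheory
open Literature.AlgebraicTopology.SingularHomology

namespace Summit.HodgeConjecture.HodgeConjecture.Cruxes.TranscendentalOrSupported.IsotypicBootstrap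

/-! ### Registered stubs

LANDED (theorems of the tree, namespace `Summit.HodgeConjecture.HodgeConjecture.Theorems`):
`stub_cruxOne` p102112, `stub_doublePerp` p102067, `stub_invisibleOfPerpSwept` p102108,
`stub_perpRatSpanned` p102808, `stub_perpSubHodge` p103396 (v1–v3); `stub_rankOne` p107230,
`stub_bootstrap` p107474, `stub_completelyReducible` p107582 (v4); `stub_cruxOne_of_middleDivisorSupport`
p114629, `stub_gysinRangeRational` p115866, `stub_gysinRangeSubHodge` p116287, `stub_bootstrapGeneral`
p116401 (v5–v6.1); `stub_transcendentalOrSupported_of_middle_of_phantomGysin` p117181 (v7, the assembly)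
and `stub_phantomGysin_of_transcendentalOrSupported` p117363 (v7, its tightness modulo Deligne 8.2.8).
OPEN: the two below. -/

/-- STUB `stub_middle` (= the route item `MiddleDivisorSupport`, stmt-HodgeConjecture-1081, VERBATIM;
no worker — it closes by name when that item lands): every rational `(p,p)`-class in the middle
cohomology `H²ᵖ` of a smooth projective `2p`-fold (`p ≥ 1`) is supported on a divisor. This is the
Hodge-conjecture part of the crux (Thomas 2005, Thm. 1: equivalent to HC given HC in lower
dimensions); here it supports the rank-one constituents of `W` (`p ≥ 2`) and settles `p = 1`
outright (`cruxOne_of_middle`). -/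
theorem stub_middle :
    Summit.HodgeConjecture.HodgeConjecture.Theses.LinearSystemTorelli.MiddleDivisorSupport := by
  sorry

/-- STUB `stub_phantomGysin` (THE GHC-PROPER RESIDUE of the crux in Gysin form, `p ≥ 2`; lead): for `X`
smooth projective of dimension `2p`, a Hodge model `A`, rational `b j ∈ H²ᵖ(X(ℂ); ℂ)` whose span `W`
pulls back to an IRREDUCIBLE sub-Hodge structure of rank `≥ 2` (hence without Hodge classes: a
"phantom" constituent) with no `(2p,0)`-part: `W` meets
`G¹ H²ᵖ(X) = ⨆_{μ, m < 2p, Y, g, a} im (g_* : Hᵃ(Y(ℂ); ℂ) → H²ᵖ(X(ℂ); ℂ))` (Gysin images from smooth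
projective varieties of smaller dimension — Grothendieck's description of `Filt'¹`, Topology 8 (1969)
p. 300) non-trivially: ONE non-zero finite sum of such Gysin classes inside `W`. "One divisor-borne
class per irreducible phantom constituent" — the content by which GHC(2p, 1) exceeds the Hodge
conjecture (Voisin, J. Open Math. Probl. 1 (2025), Conj. 4.7 / Prop. 4.8 and §4.3 (32)); open for
every `p ≥ 2`, sharpest instance `W = Λ²T(S) ⊂ H⁴(S × S)` for a K3 surface `S` with
`End_Hdg T(S) = ℚ`. Since `G¹ ≤ N¹` unconditionally and `G¹ = N¹` by Deligne's Cor. 8.2.8, this is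
v5's `stub_phantomIrreducible` with the kernel description of `N¹` traded for the Gysin one. -/
theorem stub_phantomGysin :
    ∀ ⦃p : ℕ⦄ ⦃X : SchemeOver ℂ⦄, 2 ≤ p → ∀ (hX : IsSmoothProjective (2 * p) X)
    (A : HodgeModel (2 * p) X) (r : ℕ) (b : Fin r → complexBetti X (2 * p)),
    (∀ j, IsRationalClass (b j)) →
    (Submodule.span ℂ (Set.range b)).map (A.pullback (2 * p)).hom =
      ⨆ (p' : ℕ) (q' : ℕ) (_ : p' + q' = 2 * p),
        (Submodule.span ℂ (Set.range b)).map (A.pullback (2 * p)).hom ⊓ A.hodgePQ (2 * p) p' q' →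
    (Submodule.span ℂ (Set.range b)).map (A.pullback (2 * p)).hom ⊓ A.hodgePQ (2 * p) (2 * p) 0 = ⊥ →
    (∀ V : Submodule ℂ (complexBetti X (2 * p)), V ≤ Submodule.span ℂ (Set.range b) →
      Submodule.span ℂ {x : complexBetti X (2 * p) | x ∈ V ∧ IsRationalClass x} = V →
      V.map (A.pullback (2 * p)).hom =
        ⨆ (p' : ℕ) (q' : ℕ) (_ : p' + q' = 2 * p),
          V.map (A.pullback (2 * p)).hom ⊓ A.hodgePQ (2 * p) p' q' →
      V = ⊥ ∨ V = Submodule.span ℂ (Set.range b)) →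
    2 ≤ Module.finrank ℂ (Submodule.span ℂ (Set.range b)) →
    Submodule.span ℂ (Set.range b) ⊓
      (⨆ (μ : OrientationFamily) (m : ℕ) (_ : m < 2 * p) (Y : SchemeOver ℂ)
        (hY : IsSmoothProjective m Y) (g : Y ⟶ X) (a : ℕ) (hab : a + 2 * (2 * p) = 2 * p + 2 * m),
        LinearMap.range (complexGysin μ hY hX g hab)) ≠ ⊥ := by
  sorry

/-! ### The crux by name -/

/-- **The crux `TranscendentalOrSupported` from the two open stubs** (line `Sketch`, skeleton v7; the
ONLY theorem of this file concluding the crux): the landed assembly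
`Theorems.stub_transcendentalOrSupported_of_middle_of_phantomGysin` (p117181) fed with `stub_middle`
(item 1081) and `stub_phantomGysin` (the residue). -/
theorem TranscendentalOrSupported_of :
    Summit.HodgeConjecture.HodgeConjecture.Theses.LinearSystemTorelli.TranscendentalOrSupported :=
  Summit.HodgeConjecture.HodgeConjecture.Theorems.stub_transcendentalOrSupported_of_middle_of_phantomGysin
    stub_middle stub_phantomGysin

end Summit.HodgeConjecture.HodgeConjecture.Cruxes.TranscendentalOrSupported.IsotypicBootstrap

end
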